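import Summits.BirchSwinnertonDyer.BirchSwinnertonDyer.Theses.ResidualThetaTransportAtTwo
import Summits.BirchSwinnertonDyer.BirchSwinnertonDyer.Theorems.ResidualThetaTransportAtTwoSignedMuVanishingAtTwoPlusLineV46
import Summits.BirchSwinnertonDyer.BirchSwinnertonDyer.Theorems.ResidualThetaTransportAtTwoThetaLayerLambdaCongruenceAtTwoCuspSpanRowInductionOdd
import Summits.BirchSwinnertonDyer.BirchSwinnertonDyer.Theorems.ResidualThetaTransportAtTwoSignedMuVanishingAtTwoPlusLineV42
import Summits.BirchSwinnertonDyer.BirchSwinnertonDyer.Theorems.ResidualThetaTransportAtTwoSignedMuVanishingAtTwoPlusCuspSpanNamed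
import Summits.BirchSwinnertonDyer.BirchSwinnertonDyer.Theorems.ResidualThetaTransportAtTwoSignedMuVanishingAtTwoPlusSel2
import HarnessLib

/-!
# Crux Kμ⁺ `SignedMuVanishingAtTwoPlus` (stmt-BirchSwinnertonDyer-20689), line `birth` v4.9: the node 27436 is a THEOREM at every odd
# level (`Rows.cuspSpanEvenAtTwo_of_not_two_dvd`, rtt-p3-w2 g5 / w4 g2 rows induction, p642718 ff.), so the analytic stub `stub_flatMuZeroAtTwo` is CLOSED and the crux is the seed 21438 modulo
# Abbes–Ullmo's theorem ALONE — no ERH, no Artin, no certificate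

Cell `bsd-wall`, lead `bsd-wall-rtt-p4` g9 (helper, `--supports stmt-BirchSwinnertonDyer-20689`; THEOREMS ONLY). BSD is not proved by this;
the crux is NOT closed (it hinges on the conjecture-grade seed 21438); every statement below is by name.

* `forall_cuspSpanEvenAtTwo_of_odd` — the node at every odd level in the `¬ 2 ∣ N` spelling of the Kμ⁺ files (from `Rows.cuspSpanEvenAtTwo_of_not_two_dvd`).
* `flatMuZeroAtTwo` — **`stub_flatMuZeroAtTwo` of line `birth` is a THEOREM**: for every habitat⁺ curve (indeed every `W` good supersingular
  at `2` with `a₂ = 0`, no CM, analytic rank `0`, `Δ_W < 0`), every newform `f` of `W` and every Pollack pair `(L⁺, L⁻)` at `2`: `2 ∤ L⁻`.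
* `signedMuAnalyticAtTwoPlus_of_abbesUllmo'` — **item 21437 `SignedMuAnalyticAtTwoPlus` ⟸ Abbes–Ullmo Thm. A alone** (print, cite-only;
  `…_of_pub'`: ⟸ the PUB⁵ bundle item 27435).
* `signedMuVanishingAtTwoPlus_of_seed_of_abbesUllmo` / `…_of_seed_of_pub'` — **the crux BY NAME from {21438, Abbes–Ullmo}**;
  `signedMuVanishingAtTwoPlus_iff_seed_of_abbesUllmo` — granted Abbes–Ullmo, **Kμ⁺ ⟺ 21438** (kernel-exact; with p637716 this is
  «∀ habitat⁺ W: Iwasawa μ₂(ℚ(W[2])^cyc) = 0 ∧ plus-local half» modulo {Greenberg 2011, Lim 2017, Abbes–Ullmo}).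

References: [AbbesUllmo1996] Thm. A; [Pollack2003] Conj. 6.3, Prop. 6.18; [Greenberg1999LNM] Conj. 1.11; [Kobayashi2003] Thm. 1.2.
-/

set_option autoImplicit false
-- justification: the `Summit.BirchSwinnertonDyer.BirchSwinnertonDyer.…` path repeats a component (route-file convention)
set_option linter.dupNamespace false

noncomputable section

open scoped MatrixGroups

open CongruenceSubgroup WeierstrassCurve Literature.NumberTheory.EllipticCurves
  Literature.NumberTheory.EllipticCurves.ModularForms Literature.NumberTheory.EllipticCurves.Rank1Residual
  Summit.BirchSwinnertonDyer.Rank1Residual.Supersingular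
  Summit.BirchSwinnertonDyer.BirchSwinnertonDyer.Theses.ResidualThetaTransportAtTwo

namespace Summit.BirchSwinnertonDyer.BirchSwinnertonDyer.Theorems.SignedMuAtTwo

/-- The node at every odd level, in the `¬ 2 ∣ N` spelling used by the Kμ⁺ closers. [cite: Pollack2003, Conj. 6.3] -/
theorem forall_cuspSpanEvenAtTwo_of_odd : ∀ (N : ℕ) [NeZero N], ¬ 2 ∣ N → CuspSpanEvenAtTwo N :=
  fun N _ hN ↦ Rows.cuspSpanEvenAtTwo_of_not_two_dvd N hN

/-- **FLAT at `2` on the whole habitat⁺ — `stub_flatMuZeroAtTwo` of line `birth` is a THEOREM.** For every `W/ℚ` non-CM of analytic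
rank `0`, good supersingular at `2` with `a₂ = 0` and `Δ_W < 0`, every newform `f` of `W` and every Pollack pair `(L⁺, L⁻)` at `2`:
`2 ∤ L⁻` in `Λ = ℤ₂⟦T⟧` (`μ(L♭_f) = 0`). Unconditional. BSD is not proved by this. [cite: Pollack2003, Conj. 6.3 and Prop. 6.18] -/
theorem flatMuZeroAtTwo :
    ∀ (W : WeierstrassCurve ℚ) [W.IsElliptic] [W.IsGloballyMinimal], ¬ W.HasCM → W.analyticRank = 0 →
      GoodSS W 2 → W.frobeniusTrace 2 = 0 → W.Δ < 0 →
      ∀ [NeZero (W.conductorNorm ℤ)] (f : CuspForm (Gamma0 (W.conductorNorm ℤ)) 2), IsNewformOf W f →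
      ∀ (Lplus Lminus : IwasawaAlgebra 2), IsPollackPair f 2 Lplus Lminus → ¬ PowerSeries.C (2 : ℤ_[2]) ∣ Lminus :=
  flatMuZeroAtTwo_of_forall_cuspSpanEvenAtTwo forall_cuspSpanEvenAtTwo_of_odd

/-- **Item 21437 `SignedMuAnalyticAtTwoPlus` ⟸ Abbes–Ullmo Thm. A ALONE** (print, cite-only). [cite: AbbesUllmo1996, Thm. A]
[cite: Pollack2003, Conj. 6.3 and Prop. 6.18] -/
theorem signedMuAnalyticAtTwoPlus_of_abbesUllmo' (hAU : abbesUllmo_not_dvd_maninConstant_of_not_dvd_level) :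
    SignedMuAnalyticAtTwoPlus :=
  signedMuAnalyticAtTwoPlus_of_abbesUllmo_of_forall_cuspSpanEvenAtTwo hAU forall_cuspSpanEvenAtTwo_of_odd

/-- **Item 21437 ⟸ the PUB⁵ bundle item 27435** (only its Abbes–Ullmo conjunct is used). [cite: AbbesUllmo1996, Thm. A] -/
theorem signedMuAnalyticAtTwoPlus_of_pub' (hPub : PublishedInputsHeckeAtTwo) : SignedMuAnalyticAtTwoPlus :=
  signedMuAnalyticAtTwoPlus_of_abbesUllmo' hPub.2.2.2.2

/-- **The crux Kμ⁺ BY NAME from {item 21438, Abbes–Ullmo Thm. A}.** Conditional on the seed (conjecture-grade) and one print fact.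
[cite: Greenberg1999LNM, Conj. 1.11] [cite: AbbesUllmo1996, Thm. A] -/
theorem signedMuVanishingAtTwoPlus_of_seed_of_abbesUllmo (hSeed : SignedMuSeedAtTwoPlus)
    (hAU : abbesUllmo_not_dvd_maninConstant_of_not_dvd_level) : SignedMuVanishingAtTwoPlus :=
  signedMuVanishingAtTwoPlus_iff_analytic_and_seed.mpr ⟨signedMuAnalyticAtTwoPlus_of_abbesUllmo' hAU, hSeed⟩

/-- **The crux Kμ⁺ BY NAME from {item 21438, item 27435}.** [cite: Greenberg1999LNM, Conj. 1.11] [cite: AbbesUllmo1996, Thm. A] -/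
theorem signedMuVanishingAtTwoPlus_of_seed_of_pub' (hSeed : SignedMuSeedAtTwoPlus) (hPub : PublishedInputsHeckeAtTwo) :
    SignedMuVanishingAtTwoPlus :=
  signedMuVanishingAtTwoPlus_of_seed_of_abbesUllmo hSeed hPub.2.2.2.2

/-- **Granted Abbes–Ullmo Thm. A, the crux Kμ⁺ IS the μ-seed item 21438** (kernel-exact; no ERH). With `…SexticReading` (p637716) this
reads: Kμ⁺ ⟺ ∀ habitat⁺ W [Iwasawa μ₂(ℚ(W[2])^cyc) = 0 ∧ plus-local half] modulo {Greenberg 2011, Lim 2017, Abbes–Ullmo}. BSD is not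
proved by this. [cite: Greenberg1999LNM, Conj. 1.11] [cite: AbbesUllmo1996, Thm. A] -/
theorem signedMuVanishingAtTwoPlus_iff_seed_of_abbesUllmo (hAU : abbesUllmo_not_dvd_maninConstant_of_not_dvd_level) :
    SignedMuVanishingAtTwoPlus ↔ SignedMuSeedAtTwoPlus :=
  ⟨signedMuSeedAtTwoPlus_of_signedMuVanishingAtTwoPlus, fun h ↦ signedMuVanishingAtTwoPlus_of_seed_of_abbesUllmo h hAU⟩

end Summit.BirchSwinnertonDyer.BirchSwinnertonDyer.Theorems.SignedMuAtTwo

end
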